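import Summits.CriticalPhenomena.PercolationContinuityZ3.Theorems.Transplant.FKDoubleFanSectorNC
import Summits.CriticalPhenomena.PercolationContinuityZ3.Theorems.Transplant.FKDoubleFanCrossFar
import Summits.CriticalPhenomena.PercolationContinuityZ3.Theorems.Transplant.FKConnectivityAllQEdgeToggle
import HarnessLib

/-!
# Double fans `K₂ ∨ P_{m+1}`: CONDITIONALLY ON `{a ↮ b}`, any `a`-spoke and any `b`-spoke are negatively correlated (measure level)

Helper file (`--supports stmt-CriticalPhenomena-4575`), FK sub-lane `prim-bschramm-fk-3` (gen 26); builds on p205010 (kernel theorem, internal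
audit signed; external expert review pending).  No named facts, no sorries; standard axioms.  Memo `bschramm/prim-bschramm-fk-3/FAR-CROSS.md` §3.

The measure-level form of the sector theorem `InKE.rayleigh_crossSec_nonneg` (`…DoubleFanSectorNC`).  THE AXIS TRICK: for an event `F` that
does not read the axis `g = s(a,b)`, the toggle identity of `…AllQEdgeToggle` gives
`(q⁻¹ − 1)·S_{w[g↦0]}(F ∩ {a ↮ b}) = S_{w[g↦1]}(F) − S_{w[g↦0]}(F)` and `S_{w[g↦1]}(F ∩ {a↮b}) = 0`, so every mass restricted to `{a ↮ b}` is a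
DIFFERENCE of unrestricted masses at the two axis pinnings (`sum_ind_inter_sepEv_eq`).  On the transfer side the axis letter commutes with
every block (`blockIn_axis_one`, `midWord_conv_edgeAB`) and `q·(val_q(AB(1) ∗ W) − val_q W) = (1−q)·valSep_q W` (`val_conv_edgeAB_one_sub`), so the
differences of the `crossFarZ` valuations (`…DoubleFanCrossFar`, cut formula `cut_pin_spokes_cross_far`) are the sector valuations `crossSecZ` of
`…DoubleFanSectorNC` (`crossFarZ_axis_sub`).  THEOREM **`condNegCorr_spokes_cross_far`**: for `0 < q < 1`, every weight vector supported on the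
double fan (`card V = m + 3`) and all `j < k ≤ m`,
`φ(J_{a c_j} ∩ J_{b c_k} ∩ {a↮b})·φ({a↮b}) ≤ φ(J_{a c_j} ∩ {a↮b})·φ(J_{b c_k} ∩ {a↮b})`,
i.e. conditionally on the apices not being connected the two spokes are negatively correlated — at every distance.
[cite: Grimmett2006, §3.9 eq. (3.94) (pp. 63–64); §1.4 eq. (1.20) (p. 15); Thm. (3.1)(a) (p. 37)] [folklore]
-/

noncomputable section

namespace Summit.CriticalPhenomena.PercolationContinuityZ3.Theorems

namespace FK

namespace ThreeApex

open MeasureTheory Literature.Probability.LatticeModels Literature.Probability.Percolation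
open Literature.Probability.Percolation.DecisionTree (ind ind_of_mem ind_of_not_mem ind_nonneg)
open scoped Classical symmDiff

/-! ### Transfer side: the axis letter commutes out, and `val(AB(1)∗W) − val W ∝ valSep W` -/

/-- `q·(val_q(AB(1) ∗ W) − val_q W) = (1−q)·valSep_q W`. [folklore] -/
theorem val_conv_edgeAB_one_sub (q : ℝ) (W : V5) : q * (val q (conv (edgeAB 1) W) - val q W) = (1 - q) * valSep q W := by
  simp only [val, valSep, conv, edgeAB, V5.total]; ring

/-- The axis letter commutes with the middle blocks. [folklore] -/
theorem midWord_conv_edgeAB (q t : ℝ) : ∀ (mids : List (ℝ × ℝ × ℝ)) (X : V5),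
    midWord q mids (conv (edgeAB t) X) = conv (edgeAB t) (midWord q mids X)
  | [], _ => rfl
  | blk :: rest, X => by
    show midWord q rest _ = conv (edgeAB t) (midWord q rest _)
    rw [rimStep_conv_edgeAB, conv_comm (edgeBC _) (edgeAB t), conv_comm (edgeAC _) (edgeAB t), midWord_conv_edgeAB q t rest]

/-- **The pinned valuations at the two axis pinnings differ by the sector valuation**:
`q·(crossFarZ(AB(1) ∗ u) − crossFarZ(u)) = (1−q)·crossSecZ(u)`. [folklore] -/
theorem crossFarZ_axis_sub (q : ℝ) (mids : List (ℝ × ℝ × ℝ)) (rd : ℝ) (u s : V5) (σ τ : ℝ) :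
    q * (crossFarZ q mids rd (conv (edgeAB 1) u) s σ τ - crossFarZ q mids rd u s σ τ) = (1 - q) * crossSecZ q mids rd u s σ τ := by
  simp only [crossFarZ, crossSecZ]
  rw [conv_comm (edgeAC σ) (edgeAB 1), midWord_conv_edgeAB, rimStep_conv_edgeAB, conv_comm (edgeBC τ) (edgeAB 1), conv_comm s (edgeAB 1),
    val_conv_edgeAB_one_sub]
  congr 1
  simp only [← mul_def]
  rw [← mul_assoc, mul_comm s (edgeBC τ)]

variable {V : Type*} [Fintype V]

section Setting

variable {a b : V} {c : ℕ → V} {m : ℕ}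
variable (hab : a ≠ b) (hinj : ∀ j k, j ≤ m → k ≤ m → c j = c k → j = k) (hca : ∀ j, j ≤ m → c j ≠ a) (hcb : ∀ j, j ≤ m → c j ≠ b)
include hab hinj hca hcb

omit [Fintype V] hinj in
/-- **The block inputs at the two axis pinnings**: `blockIn(w[ab↦1]) j = AB(1) ∗ blockIn(w[ab↦0]) j`. [folklore] -/
theorem blockIn_axis_one (q : ℝ) (w : Sym2 V → unitInterval) :
    ∀ j, j ≤ m → blockIn q (Function.update w s(a, b) 1) a b c j = conv (edgeAB 1) (blockIn q (Function.update w s(a, b) 0) a b c j)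
  | 0, _ => by
    simp only [blockIn, wR_update_self, Set.Icc.coe_one, Set.Icc.coe_zero, conv_edgeAB_zero]
  | j + 1, hj => by
    have hj' : j ≤ m := by omega
    have ih := blockIn_axis_one q w j hj'
    show rimStep q (wR (Function.update w s(a, b) 1) s(c j, c (j + 1))) (zDF q (Function.update w s(a, b) 1) a b c j) =
      conv (edgeAB 1) (rimStep q (wR (Function.update w s(a, b) 0) s(c j, c (j + 1))) (zDF q (Function.update w s(a, b) 0) a b c j))
    rw [zDF_eq_block q (Function.update w s(a, b) 1) a b c j, zDF_eq_block q (Function.update w s(a, b) 0) a b c j, ih,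
      wR_update_of_ne w (rim_ne_axis hca (i := j) hj) 1, wR_update_of_ne w (rim_ne_axis hca (i := j) hj) 0,
      wR_update_of_ne w (spokeA_ne_axis hab hcb hj') 1, wR_update_of_ne w (spokeA_ne_axis hab hcb hj') 0,
      wR_update_of_ne w (spokeB_ne_axis hab hca hj') 1, wR_update_of_ne w (spokeB_ne_axis hab hca hj') 0,
      conv_comm (edgeBC _) (edgeAB 1), conv_comm (edgeAC _) (edgeAB 1), rimStep_conv_edgeAB]

omit hinj hca hcb in
/-- **The restricted masses as differences.**  For `g = s(a,b)`, an event `F` that does not read `g`, and `q ≠ 0`: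
`(q⁻¹ − 1)·S_w(F ∩ {a↮b}) = (1 − w g)·(S_{w[g↦1]}(F) − S_{w[g↦0]}(F))`. [cite: Grimmett2006, Thm. (3.1)(a) (p. 37)] -/
theorem sum_ind_inter_sepEv_eq (w : Sym2 V → unitInterval) {q : ℝ} (hq : q ≠ 0) (F : Set (BondConfig V))
    (hF : ∀ ω : BondConfig V, ω ∆ {s(a, b)} ∈ F ↔ ω ∈ F) :
    (q⁻¹ - 1) * ∑ ω : BondConfig V, rcWeightW w q ∅ ω * ind (F ∩ sepEv a b) ω =
      (1 - ((w s(a, b) : unitInterval) : ℝ)) *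
        (∑ ω : BondConfig V, rcWeightW (Function.update w s(a, b) 1) q ∅ ω * ind F ω -
          ∑ ω : BondConfig V, rcWeightW (Function.update w s(a, b) 0) q ∅ ω * ind F ω) := by
  have hsep : (F ∩ sepEv a b : Set (BondConfig V)) = F ∩ (openConn a b : Set (BondConfig V))ᶜ := rfl
  -- the part with the axis almost surely open vanishes
  have h1 : ∑ ω : BondConfig V, rcWeightW (Function.update w s(a, b) 1) q ∅ ω * ind (F ∩ sepEv a b) ω = 0 := by
    refine Finset.sum_eq_zero fun ω _ => ?_
    by_cases he : s(a, b) ∈ ω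
    · have hr : (openGraph ω).Reachable a b :=
        SimpleGraph.Adj.reachable (G := openGraph ω) ((SimpleGraph.fromEdgeSet_adj _).2 ⟨he, hab⟩)
      have hc : ω ∉ F ∩ sepEv a b := fun h => h.2 hr
      rw [ind_of_not_mem hc, mul_zero]
    · rw [rcWeightW_eq_zero_of_one_not_mem (Function.update w s(a, b) 1) q ∅ (by simp) he, zero_mul]
  have htog := sum_rcWeightW_update_one_eq_toggle w hq a b F hF
  rw [sum_rcWeightW_ind_affine w q s(a, b) (F ∩ sepEv a b), h1, mul_zero, add_zero, hsep]
  have e1 : ∑ ω : BondConfig V, rcWeightW (Function.update w s(a, b) 1) q ∅ ω * ind F ω -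
      ∑ ω : BondConfig V, rcWeightW (Function.update w s(a, b) 0) q ∅ ω * ind F ω =
      (q⁻¹ - 1) * ∑ ω : BondConfig V, rcWeightW (Function.update w s(a, b) 0) q ∅ ω * ind (F ∩ (openConn a b : Set (BondConfig V))ᶜ) ω := by
    rw [htog]; ring
  rw [e1]; ring

/-- **CONDITIONALLY ON `{a ↮ b}`, THE SPOKES `a c_j` AND `b c_k` (`j < k`) ARE NEGATIVELY CORRELATED** in every weighted double fan
(`0 < q < 1`, `card V = m + 3`, `w` supported on the double fan):
`φ(J_{a c_j} ∩ J_{b c_k} ∩ {a↮b})·φ({a↮b}) ≤ φ(J_{a c_j} ∩ {a↮b})·φ(J_{b c_k} ∩ {a↮b})`. [cite: Grimmett2006, §3.9 eq. (3.94) (pp. 63–64)] -/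
theorem condNegCorr_spokes_cross_far (hcard : Fintype.card V = m + 3) {q : ℝ} (hq0 : 0 < q) (hq1 : q < 1) (w : Sym2 V → unitInterval)
    (hsupp : ∀ e, e ∉ dfPairs a b c m → w e = 0) {j k : ℕ} (hjk : j < k) (hk : k ≤ m) :
    (rcMeasureW w q ∅).real ({ω : BondConfig V | s(a, c j) ∈ ω} ∩ {ω | s(b, c k) ∈ ω} ∩ sepEv a b) * (rcMeasureW w q ∅).real (sepEv a b) ≤
      (rcMeasureW w q ∅).real ({ω : BondConfig V | s(a, c j) ∈ ω} ∩ sepEv a b) *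
        (rcMeasureW w q ∅).real ({ω : BondConfig V | s(b, c k) ∈ ω} ∩ sepEv a b) := by
  obtain ⟨d, rfl⟩ := Nat.exists_eq_add_of_lt hjk
  have hj0 : j ≤ m := by omega
  set e : Sym2 V := s(a, c j) with he_def
  set f : Sym2 V := s(b, c (j + d + 1)) with hf_def
  set g : Sym2 V := s(a, b) with hg_def
  have he : e ∈ dfPairs a b c m := (mem_dfPairs_iff a b c m _).2 (Or.inr (Or.inl ⟨j, hj0, Or.inl rfl⟩))
  have hf : f ∈ dfPairs a b c m := (mem_dfPairs_iff a b c m _).2 (Or.inr (Or.inl ⟨j + d + 1, hk, Or.inr rfl⟩))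
  have hg : g ∈ dfPairs a b c m := (mem_dfPairs_iff a b c m _).2 (Or.inl rfl)
  have hfe : f ≠ e := (spokeA_ne_spokeB hab hca (j := j) hk).symm
  have heg : e ≠ g := spokeA_ne_axis hab hcb hj0
  have hfg : f ≠ g := spokeB_ne_axis hab hca hk
  -- the two axis pinnings and their pinned partition functions
  set w₁ := Function.update w g 1 with hw₁
  set w₀ := Function.update w g 0 with hw₀
  have hs1 : ∀ x, x ∉ dfPairs a b c m → w₁ x = 0 := supp_update_dfPair w hsupp hg 1
  have hs0 : ∀ x, x ∉ dfPairs a b c m → w₀ x = 0 := supp_update_dfPair w hsupp hg 0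
  set mids := midBlocks w a b c j d with hmids
  set rd := wR w s(c (j + d), c (j + d + 1)) with hrd
  set u₀ := conv (edgeBC (wR w s(b, c j))) (blockIn q w₀ a b c j) with hu₀
  set s := conv (restVec q w a b c (j + d + 1) (m - (j + d + 1))) (edgeAC (wR w s(a, c (j + d + 1)))) with hs
  -- the cut formula at the two axis pinnings (the axis is read only by block 0: middle blocks, last rim weight and suffix do not see it)
  have hmidsI : ∀ i : unitInterval, midBlocks (Function.update w g i) a b c j d = mids := fun i =>
    midBlocks_update_eq w i j d fun k hk _ hr => absurd ((readsAt_axis_iff hab hca hcb (k := k) (by omega)).1 hr) (by omega)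
  have hrdI : ∀ i : unitInterval, wR (Function.update w g i) s(c (j + d), c (j + d + 1)) = rd := fun i =>
    wR_update_of_ne w (rim_ne_axis hca (i := j + d) hk) i
  have hrestI : ∀ i : unitInterval, restVec q (Function.update w g i) a b c (j + d + 1) (m - (j + d + 1)) =
      restVec q w a b c (j + d + 1) (m - (j + d + 1)) := fun i =>
    restVec_update_eq q w i (m - (j + d + 1)) (j + d + 1) (by omega)
      fun k hk hkm hr => absurd ((readsAt_axis_iff hab hca hcb hkm).1 hr) (by omega)
  have hxI : ∀ i : unitInterval, wR (Function.update w g i) s(a, c (j + d + 1)) = wR w s(a, c (j + d + 1)) := fun i =>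
    wR_update_of_ne w (spokeA_ne_axis hab hcb hk) i
  have hyI : ∀ i : unitInterval, wR (Function.update w g i) s(b, c j) = wR w s(b, c j) := fun i =>
    wR_update_of_ne w (spokeB_ne_axis hab hca hj0) i
  have hu1 : conv (edgeBC (wR w s(b, c j))) (blockIn q w₁ a b c j) = conv (edgeAB 1) u₀ := by
    rw [hu₀, hw₁, hw₀, blockIn_axis_one hab hca hcb q w j hj0, conv_comm]
  have hZ : ∀ (i : unitInterval) (σ τ : unitInterval),
      rcPartitionFunctionW (Function.update (Function.update (Function.update w g i) e σ) f τ) q ∅ =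
        crossFarZ q mids rd (conv (edgeBC (wR w s(b, c j))) (blockIn q (Function.update w g i) a b c j)) s (σ : ℝ) (τ : ℝ) := by
    intro i σ τ
    rw [rcPartitionFunctionW_eq_transferDF hab hinj hca hcb hcard q _
      (supp_update_dfPair _ (supp_update_dfPair _ (supp_update_dfPair w hsupp hg i) he σ) hf τ),
      cut_pin_spokes_cross_far hab hinj hca hcb q (Function.update w g i) hk σ τ, hmidsI, hrdI, hrestI, hxI, hyI]
  -- the differences of pinned partition functions are the sector valuations
  set C : ℝ → ℝ → ℝ := fun σ τ => crossSecZ q mids rd u₀ s σ τ with hC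
  have hD : ∀ σ τ : unitInterval,
      q * (rcPartitionFunctionW (Function.update (Function.update w₁ e σ) f τ) q ∅ -
        rcPartitionFunctionW (Function.update (Function.update w₀ e σ) f τ) q ∅) = (1 - q) * C (σ : ℝ) (τ : ℝ) := by
    intro σ τ
    rw [hw₁, hZ 1 σ τ, hw₀, hZ 0 σ τ, ← hw₁, ← hw₀, hu1, ← hu₀, crossFarZ_axis_sub]
  -- the algebra-level inequality
  have huK : InKE q u₀ := InKE.step (IsLetter.bc (w _).2.1 (w _).2.2) (inKE_blockIn q w₀ a b c j)
  have hsK : InKE q s := InKE.mul (inKE_restVec q w a b c (m - (j + d + 1)) (j + d + 1)) (by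
    rw [← mul_one (edgeAC (wR w s(a, c (j + d + 1)))), mul_def, one_def]
    exact InKE.step (IsLetter.ac (w _).2.1 (w _).2.2) InKE.base)
  have key : 0 ≤ C 1 0 * C 0 1 - C 1 1 * C 0 0 :=
    InKE.rayleigh_crossSec_nonneg (rd := rd) hq0.le hq1.le (unitBlocks_midBlocks w a b c j d) (w _).2.1 (w _).2.2 huK hsK
  -- masses restricted to `{a ↮ b}` as differences
  have hq' : q ≠ 0 := hq0.ne'
  have hκ : 0 < q⁻¹ - 1 := by rw [sub_pos]; exact one_lt_inv_iff₀.2 ⟨hq0, hq1⟩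
  have hFe : ∀ ω : BondConfig V, ω ∆ {g} ∈ ({ω : BondConfig V | e ∈ ω} : Set (BondConfig V)) ↔ ω ∈ ({ω : BondConfig V | e ∈ ω} : Set _) := by
    intro ω; simp only [Set.mem_setOf_eq, Set.mem_symmDiff, Set.mem_singleton_iff, heg, not_false_eq_true, and_true, false_and, or_false]
  have hFf : ∀ ω : BondConfig V, ω ∆ {g} ∈ ({ω : BondConfig V | f ∈ ω} : Set (BondConfig V)) ↔ ω ∈ ({ω : BondConfig V | f ∈ ω} : Set _) := by
    intro ω; simp only [Set.mem_setOf_eq, Set.mem_symmDiff, Set.mem_singleton_iff, hfg, not_false_eq_true, and_true, false_and, or_false]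
  have hFef : ∀ ω : BondConfig V, ω ∆ {g} ∈ ({ω : BondConfig V | e ∈ ω} ∩ {ω | f ∈ ω} : Set (BondConfig V)) ↔
      ω ∈ ({ω : BondConfig V | e ∈ ω} ∩ {ω | f ∈ ω} : Set _) := by
    intro ω; simp only [Set.mem_inter_iff, Set.mem_setOf_eq, Set.mem_symmDiff, Set.mem_singleton_iff, heg, hfg, not_false_eq_true,
      and_true, false_and, or_false]
  have hFu : ∀ ω : BondConfig V, ω ∆ {g} ∈ (Set.univ : Set (BondConfig V)) ↔ ω ∈ (Set.univ : Set _) := fun ω => by simp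
  -- unrestricted masses of the pin events at a weight vector `v` through pinned partition functions
  have mass_ef : ∀ v : Sym2 V → unitInterval,
      ∑ ω : BondConfig V, rcWeightW v q ∅ ω * ind ({ω : BondConfig V | e ∈ ω} ∩ {ω | f ∈ ω}) ω =
        ((v e : unitInterval) : ℝ) * ((v f : unitInterval) : ℝ) * rcPartitionFunctionW (Function.update (Function.update v e 1) f 1) q ∅ :=
    fun v => Wheel.sum_openPair_inter_openPair_eq v q hfe
  have mass_e : ∀ v : Sym2 V → unitInterval, ∑ ω : BondConfig V, rcWeightW v q ∅ ω * ind {ω : BondConfig V | e ∈ ω} ω =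
      ((v e : unitInterval) : ℝ) * rcPartitionFunctionW (Function.update (Function.update v e 1) f (v f)) q ∅ := by
    intro v
    rw [Wheel.sum_openPair_eq_mul_Z v q e]
    congr 2
    conv_lhs => rw [← Function.update_eq_self f (Function.update v e 1)]
    rw [Function.update_of_ne hfe]
  have mass_f : ∀ v : Sym2 V → unitInterval, ∑ ω : BondConfig V, rcWeightW v q ∅ ω * ind {ω : BondConfig V | f ∈ ω} ω =
      ((v f : unitInterval) : ℝ) * rcPartitionFunctionW (Function.update (Function.update v e (v e)) f 1) q ∅ := by
    intro v
    rw [Wheel.sum_openPair_eq_mul_Z v q f, Function.update_eq_self]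
  have mass_u : ∀ v : Sym2 V → unitInterval, ∑ ω : BondConfig V, rcWeightW v q ∅ ω * ind (Set.univ : Set (BondConfig V)) ω =
      rcPartitionFunctionW (Function.update (Function.update v e (v e)) f (v f)) q ∅ := by
    intro v
    rw [Function.update_eq_self, Function.update_eq_self]
    unfold rcPartitionFunctionW
    exact Finset.sum_congr rfl fun ω _ => by rw [ind_of_mem (Set.mem_univ ω), mul_one]
  -- the weights of `e`, `f` are the same at both axis pinnings
  have hwe1 : ((w₁ e : unitInterval) : ℝ) = ((w e : unitInterval) : ℝ) := by rw [hw₁, Function.update_of_ne heg]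
  have hwe0 : ((w₀ e : unitInterval) : ℝ) = ((w e : unitInterval) : ℝ) := by rw [hw₀, Function.update_of_ne heg]
  have hwf1 : ((w₁ f : unitInterval) : ℝ) = ((w f : unitInterval) : ℝ) := by rw [hw₁, Function.update_of_ne hfg]
  have hwf0 : ((w₀ f : unitInterval) : ℝ) = ((w f : unitInterval) : ℝ) := by rw [hw₀, Function.update_of_ne hfg]
  have hve1 : w₁ e = w e := by rw [hw₁, Function.update_of_ne heg]
  have hve0 : w₀ e = w e := by rw [hw₀, Function.update_of_ne heg]
  have hvf1 : w₁ f = w f := by rw [hw₁, Function.update_of_ne hfg]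
  have hvf0 : w₀ f = w f := by rw [hw₀, Function.update_of_ne hfg]
  -- bi-affinity of the pinned partition functions in (w e, w f), at both axis pinnings
  have hB1 := fun (σ τ : unitInterval) => rcPartitionFunctionW_biaffine w₁ q hfe σ τ
  have hB0 := fun (σ τ : unitInterval) => rcPartitionFunctionW_biaffine w₀ q hfe σ τ
  -- abbreviations for the eight pinned partition functions
  set A11 := rcPartitionFunctionW (Function.update (Function.update w₁ e 1) f 1) q ∅
  set A10 := rcPartitionFunctionW (Function.update (Function.update w₁ e 1) f 0) q ∅
  set A01 := rcPartitionFunctionW (Function.update (Function.update w₁ e 0) f 1) q ∅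
  set A00 := rcPartitionFunctionW (Function.update (Function.update w₁ e 0) f 0) q ∅
  set B11 := rcPartitionFunctionW (Function.update (Function.update w₀ e 1) f 1) q ∅
  set B10 := rcPartitionFunctionW (Function.update (Function.update w₀ e 1) f 0) q ∅
  set B01 := rcPartitionFunctionW (Function.update (Function.update w₀ e 0) f 1) q ∅
  set B00 := rcPartitionFunctionW (Function.update (Function.update w₀ e 0) f 0) q ∅
  have hC11 : q * (A11 - B11) = (1 - q) * C 1 1 := by
    have h := hD 1 1; simp only [Set.Icc.coe_one] at h; exact h
  have hC10 : q * (A10 - B10) = (1 - q) * C 1 0 := by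
    have h := hD 1 0; simp only [Set.Icc.coe_one, Set.Icc.coe_zero] at h; exact h
  have hC01 : q * (A01 - B01) = (1 - q) * C 0 1 := by
    have h := hD 0 1; simp only [Set.Icc.coe_one, Set.Icc.coe_zero] at h; exact h
  have hC00 : q * (A00 - B00) = (1 - q) * C 0 0 := by
    have h := hD 0 0; simp only [Set.Icc.coe_zero] at h; exact h
  -- the four restricted masses
  have hs0 : 0 ≤ ((w e : unitInterval) : ℝ) := (w _).2.1
  have hsl : ((w e : unitInterval) : ℝ) ≤ 1 := (w _).2.2
  have hf0 : 0 ≤ ((w f : unitInterval) : ℝ) := (w _).2.1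
  have hfl : ((w f : unitInterval) : ℝ) ≤ 1 := (w _).2.2
  have Mef := sum_ind_inter_sepEv_eq hab w hq' _ hFef
  have Me := sum_ind_inter_sepEv_eq hab w hq' _ hFe
  have Mf := sum_ind_inter_sepEv_eq hab w hq' _ hFf
  have Mu := sum_ind_inter_sepEv_eq hab w hq' _ hFu
  rw [← hg_def, ← hw₁, ← hw₀] at Mef Me Mf Mu
  rw [mass_ef, mass_ef, hwe1, hwe0, hwf1, hwf0, hB1 1 1, hB0 1 1] at Mef
  rw [mass_e, mass_e, hwe1, hwe0, hvf1, hvf0, hB1 1 (w f), hB0 1 (w f)] at Me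
  rw [mass_f, mass_f, hwf1, hwf0, hve1, hve0, hB1 (w e) 1, hB0 (w e) 1] at Mf
  rw [mass_u, mass_u, hve1, hve0, hvf1, hvf0, hB1 (w e) (w f), hB0 (w e) (w f)] at Mu
  simp only [Set.Icc.coe_one, Set.univ_inter] at Mef Me Mf Mu
  -- pass to masses
  have hZpos := rcPartitionFunctionW_pos w hq0 (∅ : Set V)
  rw [rcMeasureW_real_eq_sum_div w hq0, rcMeasureW_real_eq_sum_div w hq0, rcMeasureW_real_eq_sum_div w hq0, rcMeasureW_real_eq_sum_div w hq0,
    div_mul_div_comm, div_mul_div_comm, div_le_div_iff₀ (mul_pos hZpos hZpos) (mul_pos hZpos hZpos)]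
  refine mul_le_mul_of_nonneg_right ?_ (mul_pos hZpos hZpos).le
  -- multiply by `κ² > 0`, `κ = q⁻¹ − 1`, and insert the difference formulas
  have hκ2 : 0 < (q⁻¹ - 1) * (q⁻¹ - 1) := mul_pos hκ hκ
  refine le_of_mul_le_mul_left ?_ hκ2
  rw [show ∀ X Y : ℝ, (q⁻¹ - 1) * (q⁻¹ - 1) * (X * Y) = ((q⁻¹ - 1) * X) * ((q⁻¹ - 1) * Y) from fun X Y => by ring,
    show ∀ X Y : ℝ, (q⁻¹ - 1) * (q⁻¹ - 1) * (X * Y) = ((q⁻¹ - 1) * X) * ((q⁻¹ - 1) * Y) from fun X Y => by ring, Mef, Me, Mf, Mu]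
  -- substitute `A = B + ((1−q)/q)·C` and finish with the key identity
  have dC : ∀ {A B Cv : ℝ}, q * (A - B) = (1 - q) * Cv → A = B + (1 - q) / q * Cv := by
    intro A B Cv h; field_simp; linarith [h]
  rw [dC hC11, dC hC10, dC hC01, dC hC00]
  have hnn : 0 ≤ (1 - ((w g : unitInterval) : ℝ)) ^ 2 * (((w e : unitInterval) : ℝ) * ((w f : unitInterval) : ℝ) *
      ((1 - ((w e : unitInterval) : ℝ)) * (1 - ((w f : unitInterval) : ℝ)))) * ((1 - q) / q) ^ 2 * (C 1 0 * C 0 1 - C 1 1 * C 0 0) := by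
    have := sub_nonneg.2 hsl
    have := sub_nonneg.2 hfl
    have hpq : 0 ≤ (1 - q) / q := div_nonneg (by linarith) hq0.le
    positivity
  linear_combination hnn

end Setting

end ThreeApex

end FK

end Summit.CriticalPhenomena.PercolationContinuityZ3.Theorems
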